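import Summits.QuantumFields.BalabanUV.T4Continuum.Support.NE3EnergySmallFieldCurl
import HarnessLib

/-!
# NE7SegmentPlaquetteRadius — THE TWO-SIDED PLAQUETTE RADIUS ALONG THE EXPONENTIAL SEGMENT `s ↦ U e^{sX}`:
# every plaquette variable stays within `(1−s)·a₀ + s·a₁ + 7·Σ_{b⊂∂p}‖X(b)‖²·s(1−s)` of `1` when the two ENDPOINTS have
# radii `a₀`, `a₁` — no dressed-curl letter, no one-sidedness

Cell `pub-balaban`, rung (B)+1 sub-cell t4, lineage `b2b-balaban-t4-ne7-p1`, generation 66 (CRUX PROVER NE7 #1); hunt (h10) «ONE-STEP =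
CRIT-ONE-STEP ∧ CONV-ONE-STEP», memo `t4/b2b-balaban-t4-ne7-p1-g66/HUNT-H10-TWO-ROADS.md` §2 (the CONVEXITY ROAD for CONV-ONE-STEP: a critical
configuration of the constrained Wilson action with small field is a GLOBAL minimiser over the closed small-field class — reading D-B11-2 of
[Balaban1985Variational] Thm 1 (8) + Prop. 7 — by convexity of `s ↦ A(U e^{sX})` along the segment to the competitor).

WHY.  Every segment argument of the cell (row NE3's road P3: `NE3HessBounds.hess_self_ge`, `NE3CurlStability.hess_self_ge_vary`,
`NE3SegmentRSI.actionGap_along_segment`; this lineage's CONV-ONE-STEP) needs the moving configuration `U_s = U e^{sX}` to stay SMALL-FIELD for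
`s ∈ [0,1]`, because the diagonal Hessian lower bound carries `−7a·Σ bondSq` with `a` the plaquette radius AT `U_s`.  The tree's suppliers are
ONE-SIDED: `NE3EnergyVary.smallField_vary` (`a₀ + 4(e^{α} − 1)`, linear in the sup `α` of `X` — too weak at the class radius) and
`NE3EnergySmallFieldCurl.smallField_vary_curl'` (`a₀ + s·γ + 24e^{sα}s²α²`, with the dressed-curl sup `γ` of `X` as an extra letter).  For the pair
(critical configuration, competitor) BOTH endpoints lie in the class, and the natural statement is the TWO-SIDED one proved here:
**`norm_hol_vary_sub_one_le_interp`** — for unitary `U`, skew `X`, every plaquette `p′ = (z; μ, ν)` and `s ∈ [0,1]`,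
  `‖U_s(∂p′) − 1‖ ≤ (1−s)·‖U(∂p′) − 1‖ + s·‖U_1(∂p′) − 1‖ + 7·bondSqAt X p′·s(1−s)`,
the non-abelian correction to the affine interpolation of the plaquette variable being SECOND ORDER in `X` (abelian: the plaquette angle is affine
in `s`, no correction).  Mechanism (§1–§3): `h(s) = U_s(∂p′)` has `h′ = (d_{U_s}X)(p′)·h` (the tree's `hasDerivAt_hol_vary` transported by the group
law `vary_add`: row NE3's `NE3EnergySmallFieldCurl.hasDerivAt_hol_vary_at`, by name) and `h″ = (dcurlAt U_s X X p′ + (d_{U_s}X)(p′)²)·h` with `‖h″‖ ≤ (3 + 4)·bondSqAt X p′` (`NE3HessBounds.norm_dcurlAt_self_le`,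
`norm_curlAt_sq_le`, `‖h‖ ≤ 1`); two first-order mean value inequalities (Mathlib's `Convex.norm_image_sub_le_of_norm_hasDerivWithin_le`, no
integral) give `‖h(s) − (1−s)h(0) − s·h(1)‖ ≤ 7·bondSqAt·s(1−s)` (**`norm_hol_vary_sub_interp_le`**).  Consequences (§4):
**`smallField_vary_segment`** — `SmallField U a₀`, `SmallField (U e^{X}) a₁`, `‖X(b)‖ ≤ α` ⟹ `SmallField (U e^{sX}) ((1−s)a₀ + s·a₁ + 28α²·s(1−s))`
for `s ∈ [0,1]`, and **`smallField_vary_segment_max`** — radius `max a₀ a₁ + 7α²`, uniform on the segment.  Reading for CONV-ONE-STEP (memo H10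
§2): endpoints of radius `≤ ε(L^{k+1})^{−2}` and a representative `X` of sup `α = O(ε·L^{−(k+1)})` ([Balaban1985Variational] Prop. 2 TYPE) keep the
whole segment inside radius `(ε + 7·O(ε)²)(L^{k+1})^{−2}` — the SAME ORDER as the class, which is what the `−7a·Σ bondSq` slack of `hess_self_ge`
tolerates against the k-uniform slice Poincaré constant (`NE3ClassSlicePoincare`); a representative of sup `O(ε)` only would NOT (correction `O(ε²)
≫ ε(L^{k+1})^{−2}`), which is why the representation letter must be the Prop. 2 TYPE and not the block-axial one (memo H10 §2 (c)).
HONEST FRAMING (page 1): [folklore] matrix calculus over the tree's `vary`, `hol`, `curlAt`, `dcurlAt`, `bondSqAt`; NOTHING is asserted about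
Bałaban's minimisers; 0 def, 0 sorry; NOT ONE-STEP, NOT NE7; spine 0∕9; finite T⁴ rung (B)+1 — NOT infinite volume, NOT mass gap, NOT Clay.
Continuum YM on T⁴ ⇐ BetaPertH ∧ nine spine estimates (0/9 proved); BetaPertH ⇐ (D1) ∧ (D4) ∧ CAP+tail; G-an2-4 gates asym, D1 and NE2/3/4.
-/

set_option autoImplicit false

open scoped BigOperators Matrix.Norms.L2Operator
open NormedSpace Finset Set

namespace Summit.QuantumFields.BalabanUV.T4Continuum.NE7SegmentPlaquetteRadius

open Literature.MathematicalPhysics.QuantumFieldTheory.Balaban1983to89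
open B7Prop1Explicit B7Prop2Explicit MatrixLog UnitaryModel
open T4AveragingDeficitWall hiding Site Plane Plaq Bond
open AveragingDeficitTransport (mem_U1_of_unitary)
open AveragingDeficitPlaqDeriv (vary_isUnitaryCfg)
open NE3HessForm (dcurlAt vary_add hasDerivAt_curlAt_vary)
open NE3HessBounds (bondSqAt norm_curlAt_sq_le norm_dcurlAt_self_le)
open NE3EnergySmallFieldCurl (hasDerivAt_hol_vary_at)

noncomputable section

variable {d : ℕ} {n : Type*} [Fintype n] [DecidableEq n]

/-! ## §1 The dressed curl and the velocity along the segment: derivatives AT EVERY `s`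
(`d/ds U_s(∂p′) = (d_{U_s}X)(p′)·U_s(∂p′)` at every `s` is the tree's `NE3EnergySmallFieldCurl.hasDerivAt_hol_vary_at`, used by name) -/

/-- **`d/ds (d_{U_s}Y)(p′) = dcurlAt U_s X Y p′` at every `s`** (the tree's `hasDerivAt_curlAt_vary` transported by `vary_add`). [folklore] -/
theorem hasDerivAt_curlAt_vary_at (V : Site d → Fin d → (Matrix n n ℂ)ˣ) (X Y : Site d → Fin d → Matrix n n ℂ) (z : Site d) (μ ν : Fin d) (s : ℝ) :
    HasDerivAt (fun t : ℝ => curlAt (vary V X t) Y z μ ν) (dcurlAt (vary V X s) X Y z μ ν) s := by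
  have h0 := hasDerivAt_curlAt_vary (vary V X s) X Y z μ ν
  have h1 : HasDerivAt (fun t : ℝ => t - s) 1 s := by simpa using (hasDerivAt_id s).sub_const s
  have h2 := h0.scomp_of_eq s h1 (by simp)
  refine (h2.congr_of_eventuallyEq (Filter.Eventually.of_forall fun t => ?_)).congr_deriv (by simp)
  simp only [Function.comp_def, ← vary_add, add_sub_cancel]

/-- **THE SECOND DERIVATIVE**: with `h(t) = U_t(∂p′)` and `h₁(t) = (d_{U_t}X)(p′)·U_t(∂p′) = h′(t)`,
`d/ds h₁ = dcurlAt U_s X X p′ · U_s(∂p′) + (d_{U_s}X)(p′)·((d_{U_s}X)(p′)·U_s(∂p′))`. [folklore] -/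
theorem hasDerivAt_velocity_at (V : Site d → Fin d → (Matrix n n ℂ)ˣ) (X : Site d → Fin d → Matrix n n ℂ) (z : Site d) (μ ν : Fin d) (s : ℝ) :
    HasDerivAt (fun t : ℝ => curlAt (vary V X t) X z μ ν * ((hol (vary V X t) z (plaqWord μ ν) : (Matrix n n ℂ)ˣ) : Matrix n n ℂ))
      (dcurlAt (vary V X s) X X z μ ν * ((hol (vary V X s) z (plaqWord μ ν) : (Matrix n n ℂ)ˣ) : Matrix n n ℂ)
        + curlAt (vary V X s) X z μ ν * (curlAt (vary V X s) X z μ ν * ((hol (vary V X s) z (plaqWord μ ν) : (Matrix n n ℂ)ˣ) : Matrix n n ℂ))) s :=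
  (hasDerivAt_curlAt_vary_at V X X z μ ν s).mul (hasDerivAt_hol_vary_at V X z μ ν s)

/-! ## §2 The norm bound `‖h″‖ ≤ 7·bondSqAt X p′` -/

/-- **`‖h″(s)‖ ≤ 7·bondSqAt X p′`** for unitary `U` and skew `X` (`3` from `norm_dcurlAt_self_le`, `4` from `norm_curlAt_sq_le`, and
`‖U_s(∂p′)‖ ≤ 1`). [folklore] -/
theorem norm_acceleration_le [Nonempty n] {V : Site d → Fin d → (Matrix n n ℂ)ˣ} (hV : IsUnitaryCfg V) {X : Site d → Fin d → Matrix n n ℂ} (hX : IsSkewDir X)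
    (z : Site d) (μ ν : Fin d) (s : ℝ) :
    ‖dcurlAt (vary V X s) X X z μ ν * ((hol (vary V X s) z (plaqWord μ ν) : (Matrix n n ℂ)ˣ) : Matrix n n ℂ)
        + curlAt (vary V X s) X z μ ν * (curlAt (vary V X s) X z μ ν * ((hol (vary V X s) z (plaqWord μ ν) : (Matrix n n ℂ)ˣ) : Matrix n n ℂ))‖
      ≤ 7 * bondSqAt X z μ ν := by
  have hVs : IsUnitaryCfg (vary V X s) := vary_isUnitaryCfg hV hX s
  set H : Matrix n n ℂ := ((hol (vary V X s) z (plaqWord μ ν) : (Matrix n n ℂ)ˣ) : Matrix n n ℂ) with hH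
  set C : Matrix n n ℂ := curlAt (vary V X s) X z μ ν with hC
  set D : Matrix n n ℂ := dcurlAt (vary V X s) X X z μ ν with hD
  have hHn : ‖H‖ ≤ 1 :=
    (mem_U1_of_unitary (hol_mem_of (S := unitaryUnits (Matrix n n ℂ)) (fun y κ => hVs y κ) z (plaqWord μ ν))).1
  have hDn : ‖D‖ ≤ 3 * bondSqAt X z μ ν := norm_dcurlAt_self_le hVs X z μ ν
  have hCn : ‖C‖ ^ 2 ≤ 4 * bondSqAt X z μ ν := norm_curlAt_sq_le hVs X z μ ν
  have hB : 0 ≤ bondSqAt X z μ ν := by unfold bondSqAt; positivity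
  calc ‖D * H + C * (C * H)‖ ≤ ‖D * H‖ + ‖C * (C * H)‖ := norm_add_le _ _
    _ ≤ ‖D‖ * ‖H‖ + ‖C‖ * (‖C‖ * ‖H‖) := by
        refine add_le_add (norm_mul_le _ _) ((norm_mul_le _ _).trans ?_)
        exact mul_le_mul_of_nonneg_left (norm_mul_le _ _) (norm_nonneg _)
    _ ≤ ‖D‖ * 1 + ‖C‖ * (‖C‖ * 1) := by
        gcongr
    _ = ‖D‖ + ‖C‖ ^ 2 := by ring
    _ ≤ 3 * bondSqAt X z μ ν + 4 * bondSqAt X z μ ν := add_le_add hDn hCn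
    _ = 7 * bondSqAt X z μ ν := by ring

/-! ## §3 Two mean value inequalities and the interpolation bound -/

/-- The velocity `h₁ = h′` is `7·bondSqAt`-Lipschitz: `‖h₁(σ) − h₁(s)‖ ≤ 7·bondSqAt X p′·|σ − s|`. [folklore] -/
theorem norm_velocity_sub_le [Nonempty n] {V : Site d → Fin d → (Matrix n n ℂ)ˣ} (hV : IsUnitaryCfg V) {X : Site d → Fin d → Matrix n n ℂ} (hX : IsSkewDir X)
    (z : Site d) (μ ν : Fin d) (σ s : ℝ) :
    ‖curlAt (vary V X σ) X z μ ν * ((hol (vary V X σ) z (plaqWord μ ν) : (Matrix n n ℂ)ˣ) : Matrix n n ℂ)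
        - curlAt (vary V X s) X z μ ν * ((hol (vary V X s) z (plaqWord μ ν) : (Matrix n n ℂ)ˣ) : Matrix n n ℂ)‖
      ≤ 7 * bondSqAt X z μ ν * |σ - s| := by
  have h := Convex.norm_image_sub_le_of_norm_hasDerivWithin_le (s := Set.univ)
    (f := fun t : ℝ => curlAt (vary V X t) X z μ ν * ((hol (vary V X t) z (plaqWord μ ν) : (Matrix n n ℂ)ˣ) : Matrix n n ℂ))
    (fun t _ => (hasDerivAt_velocity_at V X z μ ν t).hasDerivWithinAt) (fun t _ => norm_acceleration_le hV hX z μ ν t)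
    convex_univ (Set.mem_univ s) (Set.mem_univ σ)
  simpa [Real.norm_eq_abs] using h

/-- **ONE-SIDED TAYLOR BOUND AT THE VELOCITY OF THE POINT `s`**: for `σ, s` real,
`‖h(σ) − h(s) − (σ − s)·h₁(s)‖ ≤ 7·bondSqAt X p′·(σ − s)²` (first-order mean value inequality applied to `t ↦ h(t) − t·h₁(s)` on the
segment between `s` and `σ`, whose derivative `h₁(t) − h₁(s)` is at most `7·bondSqAt·|σ − s|` there). [folklore] -/
theorem norm_hol_taylor_le [Nonempty n] {V : Site d → Fin d → (Matrix n n ℂ)ˣ} (hV : IsUnitaryCfg V) {X : Site d → Fin d → Matrix n n ℂ} (hX : IsSkewDir X)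
    (z : Site d) (μ ν : Fin d) (s σ : ℝ) :
    ‖((hol (vary V X σ) z (plaqWord μ ν) : (Matrix n n ℂ)ˣ) : Matrix n n ℂ) - ((hol (vary V X s) z (plaqWord μ ν) : (Matrix n n ℂ)ˣ) : Matrix n n ℂ)
        - (σ - s) • (curlAt (vary V X s) X z μ ν * ((hol (vary V X s) z (plaqWord μ ν) : (Matrix n n ℂ)ˣ) : Matrix n n ℂ))‖
      ≤ 7 * bondSqAt X z μ ν * (σ - s) ^ 2 := by
  set w : Matrix n n ℂ := curlAt (vary V X s) X z μ ν * ((hol (vary V X s) z (plaqWord μ ν) : (Matrix n n ℂ)ˣ) : Matrix n n ℂ) with hw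
  set f : ℝ → Matrix n n ℂ := fun t => ((hol (vary V X t) z (plaqWord μ ν) : (Matrix n n ℂ)ˣ) : Matrix n n ℂ) - t • w with hf
  have hB : 0 ≤ bondSqAt X z μ ν := by unfold bondSqAt; positivity
  -- derivative of `f`
  have hfd : ∀ t : ℝ, HasDerivAt f (curlAt (vary V X t) X z μ ν * ((hol (vary V X t) z (plaqWord μ ν) : (Matrix n n ℂ)ˣ) : Matrix n n ℂ) - w) t := by
    intro t
    have h1 := hasDerivAt_hol_vary_at V X z μ ν t
    have h2 : HasDerivAt (fun t : ℝ => t • w) ((1 : ℝ) • w) t := (hasDerivAt_id t).smul_const w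
    rw [one_smul] at h2
    exact h1.sub h2
  -- on the segment `[[s, σ]]` the derivative is at most `7·bondSq·|σ − s|`
  have hbound : ∀ t ∈ Set.uIcc s σ, ‖curlAt (vary V X t) X z μ ν * ((hol (vary V X t) z (plaqWord μ ν) : (Matrix n n ℂ)ˣ) : Matrix n n ℂ) - w‖
      ≤ 7 * bondSqAt X z μ ν * |σ - s| := by
    intro t ht
    refine (norm_velocity_sub_le hV hX z μ ν t s).trans (mul_le_mul_of_nonneg_left ?_ (by positivity))
    exact Set.abs_sub_left_of_mem_uIcc ht
  have h := Convex.norm_image_sub_le_of_norm_hasDerivWithin_le (s := Set.uIcc s σ) (f := f)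
    (fun t _ => (hfd t).hasDerivWithinAt) hbound (convex_uIcc s σ) Set.left_mem_uIcc Set.right_mem_uIcc
  have hfs : f σ - f s = ((hol (vary V X σ) z (plaqWord μ ν) : (Matrix n n ℂ)ˣ) : Matrix n n ℂ) - ((hol (vary V X s) z (plaqWord μ ν) : (Matrix n n ℂ)ˣ) : Matrix n n ℂ)
      - (σ - s) • w := by
    simp only [hf, sub_smul]; abel
  rw [hfs] at h
  refine h.trans ?_
  rw [Real.norm_eq_abs, mul_assoc, ← sq_abs (σ - s), sq]

/-- **THE INTERPOLATION BOUND**: for `s ∈ [0,1]`,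
`‖U_s(∂p′) − ((1−s)·U(∂p′) + s·U_1(∂p′))‖ ≤ 7·bondSqAt X p′·s(1−s)` — by the identity
`h(s) − (1−s)h(0) − s·h(1) = −(1−s)·[h(0) − h(s) − (0 − s)h₁(s)] − s·[h(1) − h(s) − (1 − s)h₁(s)]` and §3's two Taylor bounds
(`(1−s)·s² + s·(1−s)² = s(1−s)`). [folklore] -/
theorem norm_hol_vary_sub_interp_le [Nonempty n] {V : Site d → Fin d → (Matrix n n ℂ)ˣ} (hV : IsUnitaryCfg V) {X : Site d → Fin d → Matrix n n ℂ}
    (hX : IsSkewDir X) (z : Site d) (μ ν : Fin d) {s : ℝ} (hs : s ∈ Set.Icc (0 : ℝ) 1) :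
    ‖((hol (vary V X s) z (plaqWord μ ν) : (Matrix n n ℂ)ˣ) : Matrix n n ℂ)
        - ((1 - s) • ((hol V z (plaqWord μ ν) : (Matrix n n ℂ)ˣ) : Matrix n n ℂ) + s • ((hol (vary V X 1) z (plaqWord μ ν) : (Matrix n n ℂ)ˣ) : Matrix n n ℂ))‖
      ≤ 7 * bondSqAt X z μ ν * (s * (1 - s)) := by
  obtain ⟨hs0, hs1⟩ := hs
  have hB : 0 ≤ bondSqAt X z μ ν := by unfold bondSqAt; positivity
  set h0 : Matrix n n ℂ := ((hol V z (plaqWord μ ν) : (Matrix n n ℂ)ˣ) : Matrix n n ℂ) with hh0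
  set hS : Matrix n n ℂ := ((hol (vary V X s) z (plaqWord μ ν) : (Matrix n n ℂ)ˣ) : Matrix n n ℂ) with hhS
  set h1 : Matrix n n ℂ := ((hol (vary V X 1) z (plaqWord μ ν) : (Matrix n n ℂ)ˣ) : Matrix n n ℂ) with hh1
  set w : Matrix n n ℂ := curlAt (vary V X s) X z μ ν * hS with hw
  have hV0 : vary V X 0 = V := by
    funext x κ; simp [vary]
  have E0 := norm_hol_taylor_le hV hX z μ ν s 0
  have E1 := norm_hol_taylor_le hV hX z μ ν s 1
  rw [hV0] at E0
  -- the algebraic identity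
  have hid : hS - ((1 - s) • h0 + s • h1)
      = -((1 - s) • (h0 - hS - (0 - s) • w)) - s • (h1 - hS - (1 - s) • w) := by
    simp only [smul_sub, sub_smul, smul_smul, zero_sub, neg_smul, one_smul, smul_neg]
    module
  rw [hid]
  calc ‖-((1 - s) • (h0 - hS - (0 - s) • w)) - s • (h1 - hS - (1 - s) • w)‖
      ≤ ‖-((1 - s) • (h0 - hS - (0 - s) • w))‖ + ‖s • (h1 - hS - (1 - s) • w)‖ := norm_sub_le _ _
    _ = (1 - s) * ‖h0 - hS - (0 - s) • w‖ + s * ‖h1 - hS - (1 - s) • w‖ := by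
        rw [norm_neg, norm_smul, norm_smul, Real.norm_eq_abs, Real.norm_eq_abs, abs_of_nonneg (by linarith),
          abs_of_nonneg hs0]
    _ ≤ (1 - s) * (7 * bondSqAt X z μ ν * (0 - s) ^ 2) + s * (7 * bondSqAt X z μ ν * (1 - s) ^ 2) :=
        add_le_add (mul_le_mul_of_nonneg_left E0 (by linarith)) (mul_le_mul_of_nonneg_left E1 hs0)
    _ = 7 * bondSqAt X z μ ν * (s * (1 - s)) := by ring

/-- **THE TWO-SIDED PLAQUETTE RADIUS ALONG THE SEGMENT**: for unitary `U`, skew `X`, `s ∈ [0,1]`,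
`‖U_s(∂p′) − 1‖ ≤ (1−s)·‖U(∂p′) − 1‖ + s·‖U_1(∂p′) − 1‖ + 7·bondSqAt X p′·s(1−s)`. [folklore] -/
theorem norm_hol_vary_sub_one_le_interp [Nonempty n] {V : Site d → Fin d → (Matrix n n ℂ)ˣ} (hV : IsUnitaryCfg V) {X : Site d → Fin d → Matrix n n ℂ}
    (hX : IsSkewDir X) (z : Site d) (μ ν : Fin d) {s : ℝ} (hs : s ∈ Set.Icc (0 : ℝ) 1) :
    ‖((hol (vary V X s) z (plaqWord μ ν) : (Matrix n n ℂ)ˣ) : Matrix n n ℂ) - 1‖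
      ≤ (1 - s) * ‖((hol V z (plaqWord μ ν) : (Matrix n n ℂ)ˣ) : Matrix n n ℂ) - 1‖ + s * ‖((hol (vary V X 1) z (plaqWord μ ν) : (Matrix n n ℂ)ˣ) : Matrix n n ℂ) - 1‖
        + 7 * bondSqAt X z μ ν * (s * (1 - s)) := by
  obtain ⟨hs0, hs1⟩ := hs
  set h0 : Matrix n n ℂ := ((hol V z (plaqWord μ ν) : (Matrix n n ℂ)ˣ) : Matrix n n ℂ)
  set hS : Matrix n n ℂ := ((hol (vary V X s) z (plaqWord μ ν) : (Matrix n n ℂ)ˣ) : Matrix n n ℂ)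
  set h1 : Matrix n n ℂ := ((hol (vary V X 1) z (plaqWord μ ν) : (Matrix n n ℂ)ˣ) : Matrix n n ℂ)
  have key := norm_hol_vary_sub_interp_le hV hX z μ ν ⟨hs0, hs1⟩
  have hsplit : hS - 1 = (hS - ((1 - s) • h0 + s • h1)) + ((1 - s) • (h0 - 1) + s • (h1 - 1)) := by
    simp only [smul_sub, sub_smul, one_smul]; abel
  rw [hsplit]
  calc ‖(hS - ((1 - s) • h0 + s • h1)) + ((1 - s) • (h0 - 1) + s • (h1 - 1))‖
      ≤ ‖hS - ((1 - s) • h0 + s • h1)‖ + ‖(1 - s) • (h0 - 1) + s • (h1 - 1)‖ := norm_add_le _ _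
    _ ≤ 7 * bondSqAt X z μ ν * (s * (1 - s)) + ((1 - s) * ‖h0 - 1‖ + s * ‖h1 - 1‖) := by
        refine add_le_add key ((norm_add_le _ _).trans (le_of_eq ?_))
        rw [norm_smul, norm_smul, Real.norm_eq_abs, Real.norm_eq_abs, abs_of_nonneg (by linarith), abs_of_nonneg hs0]
    _ = (1 - s) * ‖h0 - 1‖ + s * ‖h1 - 1‖ + 7 * bondSqAt X z μ ν * (s * (1 - s)) := by ring

/-! ## §4 The `SmallField` forms -/

/-- `bondSqAt X p′ ≤ 4α²` under the sup bound `‖X(b)‖ ≤ α`. [folklore] -/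
theorem bondSqAt_le_of_sup {X : Site d → Fin d → Matrix n n ℂ} {α : ℝ} (hXα : ∀ x κ, ‖X x κ‖ ≤ α) (z : Site d) (μ ν : Fin d) :
    bondSqAt X z μ ν ≤ 4 * α ^ 2 := by
  have hα : 0 ≤ α := (norm_nonneg _).trans (hXα z μ)
  have h1 := hXα z μ
  have h2 := hXα (z + e μ) ν
  have h3 := hXα (z + e ν) μ
  have h4 := hXα z ν
  unfold bondSqAt
  nlinarith [norm_nonneg (X z μ), norm_nonneg (X (z + e μ) ν), norm_nonneg (X (z + e ν) μ), norm_nonneg (X z ν)]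

/-- **`SmallField` ALONG THE SEGMENT, TWO-SIDED**: `SmallField U a₀`, `SmallField (U e^{X}) a₁`, `U` unitary, `X` skew with `‖X(b)‖ ≤ α`
everywhere, `s ∈ [0,1]` ⟹ `SmallField (U e^{sX}) ((1−s)·a₀ + s·a₁ + 28α²·s(1−s))`. [folklore] -/
theorem smallField_vary_segment [Nonempty n] {V : Site d → Fin d → (Matrix n n ℂ)ˣ} (hV : IsUnitaryCfg V) {X : Site d → Fin d → Matrix n n ℂ}
    (hX : IsSkewDir X) {a₀ a₁ α : ℝ} (h0 : SmallField V a₀) (h1 : SmallField (vary V X 1) a₁) (hXα : ∀ x κ, ‖X x κ‖ ≤ α)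
    {s : ℝ} (hs : s ∈ Set.Icc (0 : ℝ) 1) :
    SmallField (vary V X s) ((1 - s) * a₀ + s * a₁ + 28 * α ^ 2 * (s * (1 - s))) := by
  obtain ⟨hs0, hs1⟩ := hs
  intro z μ ν hμν
  have key := norm_hol_vary_sub_one_le_interp hV hX z μ ν ⟨hs0, hs1⟩
  have hb := bondSqAt_le_of_sup hXα z μ ν
  have e0 := h0 z μ ν hμν
  have e1 := h1 z μ ν hμν
  have hss : 0 ≤ s * (1 - s) := mul_nonneg hs0 (by linarith)
  have t1 : (1 - s) * ‖((hol V z (plaqWord μ ν) : (Matrix n n ℂ)ˣ) : Matrix n n ℂ) - 1‖ ≤ (1 - s) * a₀ := mul_le_mul_of_nonneg_left e0 (by linarith)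
  have t2 : s * ‖((hol (vary V X 1) z (plaqWord μ ν) : (Matrix n n ℂ)ˣ) : Matrix n n ℂ) - 1‖ ≤ s * a₁ := mul_le_mul_of_nonneg_left e1 hs0
  have t3 : 7 * bondSqAt X z μ ν * (s * (1 - s)) ≤ 28 * α ^ 2 * (s * (1 - s)) := by nlinarith
  linarith

/-- **UNIFORM FORM**: under the same hypotheses `SmallField (U e^{sX}) (max a₀ a₁ + 7α²)` for every `s ∈ [0,1]` (`s(1−s) ≤ 1∕4`). [folklore] -/
theorem smallField_vary_segment_max [Nonempty n] {V : Site d → Fin d → (Matrix n n ℂ)ˣ} (hV : IsUnitaryCfg V) {X : Site d → Fin d → Matrix n n ℂ}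
    (hX : IsSkewDir X) {a₀ a₁ α : ℝ} (h0 : SmallField V a₀) (h1 : SmallField (vary V X 1) a₁) (hXα : ∀ x κ, ‖X x κ‖ ≤ α)
    {s : ℝ} (hs : s ∈ Set.Icc (0 : ℝ) 1) :
    SmallField (vary V X s) (max a₀ a₁ + 7 * α ^ 2) := by
  obtain ⟨hs0, hs1⟩ := hs
  have h := smallField_vary_segment hV hX h0 h1 hXα ⟨hs0, hs1⟩
  intro z μ ν hμν
  refine (h z μ ν hμν).trans ?_
  have hm0 : a₀ ≤ max a₀ a₁ := le_max_left _ _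
  have hm1 : a₁ ≤ max a₀ a₁ := le_max_right _ _
  have hq : s * (1 - s) ≤ 1 / 4 := by nlinarith [sq_nonneg (s - 1 / 2)]
  have hα2 : 0 ≤ α ^ 2 := sq_nonneg α
  nlinarith

/-- **THE SYMMETRIC CLASS FORM** (the shape CONV-ONE-STEP consumes): both endpoints in the plaquette-radius class `a` and `‖X(b)‖ ≤ α` ⟹ the
whole segment lies in the class `a + 7α²`. [folklore] -/
theorem smallField_vary_segment_class [Nonempty n] {V : Site d → Fin d → (Matrix n n ℂ)ˣ} (hV : IsUnitaryCfg V) {X : Site d → Fin d → Matrix n n ℂ}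
    (hX : IsSkewDir X) {a α : ℝ} (h0 : SmallField V a) (h1 : SmallField (vary V X 1) a) (hXα : ∀ x κ, ‖X x κ‖ ≤ α)
    {s : ℝ} (hs : s ∈ Set.Icc (0 : ℝ) 1) :
    SmallField (vary V X s) (a + 7 * α ^ 2) := by
  have h := smallField_vary_segment_max hV hX h0 h1 hXα hs
  rwa [max_self] at h

end

end Summit.QuantumFields.BalabanUV.T4Continuum.NE7SegmentPlaquetteRadius
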